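import Mathlib
import HarnessLib

/-!
# Finite differences of a product of linear factors far from its roots:
# `|Δ^m P(y)| ≤ (b/R)^m · e^{bm/R} · |P(y)|` for `P = Π_{i<b}(X − r_i)` and `dist([y, y+m], roots) ≥ R`

Elementary real analysis of a real-rooted polynomial `P(X) = Π_{i<b}(X − r_i)` (`r : ℕ → ℝ` any sequence of
roots, repetitions allowed) AWAY from its roots:

* §1 `exists_fwdDiff_iter_eval_eq_iterate_derivative_eval` — THE ITERATED MEAN VALUE THEOREM FOR FORWARD
  DIFFERENCES: for every real polynomial `p`, base point `y` and order `m` there is `ξ ∈ [y, y+m]` with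
  `Δ₁^m (p.eval) (y) = p^{(m)}(ξ)` (Mathlib `exists_deriv_eq_slope` + `Polynomial.deriv`, and `Δ₁` commutes with
  the derivative through the shift polynomial `p.comp (X + 1) − p`).
* §2 `abs_iterate_derivative_eval_prod_le` — THE LOGARITHMIC-DERIVATIVE BOUND: if `|ξ − r_i| ≥ R > 0` for all
  `i < b` then `|P^{(m)}(ξ)| ≤ (b/R)^m·|P(ξ)|` (induction on `b` with Leibniz for a linear factor,
  `((X−a)q)^{(m)} = (X−a)q^{(m)} + m·q^{(m−1)}`, and `b^m + m·b^{m−1} ≤ (b+1)^m`) — the familiar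
  `P^{(m)}/P = m!·e_m(1/(ξ−r_i))` in inequality form.
* §3 `abs_eval_prod_le_exp_mul` — moving the evaluation point: `|P(ξ)| ≤ e^{bm/R}·|P(y)|` when `|ξ − y| ≤ m` and
  `|y − r_i| ≥ R + m`.
* §4 **`abs_fwdDiff_iter_eval_prod_le`** — THE FAR-ROOTS DIFFERENCE BOUND: if `|y − r_i| ≥ R + m` for all `i < b`
  (`R > 0`) then `|Δ₁^m P (y)| ≤ (b/R)^m·e^{bm/R}·|P(y)|`; `abs_fwdDiff_iter_eval_const_mul_prod_le` is the same for
  `c·P`.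

Use (cell pnp-psdrank, eng MEMO-22 §6 (K4)): the hypergeometric law in its POPULATION parameter,
`K ↦ C(K,y)C(N−K,b−y)/C(N,b) = (C(b,y)/(N)_b)·(K)_y·(N−K)_{b−y}`, is `±` a constant times `Π_{i<y}(K − i)·
Π_{j<b−y}(K − (N−j))`, a product of `b` linear factors whose roots lie in `[0,b] ∪ [N−b,N]`; on the window
`|K − t/2| ≤ D+1` they are `≥ N/2 − b − D − 1` away, so the `2k`-fold central differences that ARE the `k`-fold level
differences of the shell law of a block without internal edges (`BinomialSmoothingProfile`) are
`(b/R)^{2k}e^{2kb/R}`-small relative to the law itself — virtual positivity of small blocks with no window, no tail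
and no Gaussian comparison. Folklore calculus; instrument/support material for the OPEN crux `TracialDecayExp20`
of route `ChebyshevTracialDesign` — nothing here is a statement about that crux, about psd rank, or about P vs NP.

## References
* [Agarwal2000DifferenceEquations] R. P. Agarwal, *Difference Equations and Inequalities*, 2nd ed. (2000),
  §1.8 (Remark 1.8.1: forward differences and derivatives, `Δ^m f(y) = f^{(m)}(ξ)`).
* [Feller1968] W. Feller, *An Introduction to Probability Theory and Its Applications*, Vol. I, 3rd ed. (1968),
  Ch. II §12 (binomial identities; `(b+1)^m ≥ b^m + m b^{m−1}`).
-/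

noncomputable section

open Finset Polynomial

namespace Literature.Algebra.Polynomial

namespace RealRootedFarDifferences

/-! ### §1 Forward differences of polynomial values are derivatives at intermediate points -/

/-- The shift-difference polynomial evaluates to the forward difference: `(p.comp(X+1) − p)(y) = p(y+1) − p(y)`.
[cite: Agarwal2000DifferenceEquations, Remark 1.8.1] -/
theorem eval_comp_X_add_one_sub (p : ℝ[X]) (y : ℝ) :
    (p.comp (X + C 1) - p).eval y = fwdDiff (1 : ℝ) (fun z => p.eval z) y := by
  simp [fwdDiff, eval_comp]

/-- The derivative commutes with the unit shift: `(p.comp(X+1) − p)' = p'.comp(X+1) − p'`.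
[cite: Agarwal2000DifferenceEquations, Remark 1.8.1] -/
theorem derivative_comp_X_add_one_sub (p : ℝ[X]) :
    derivative (p.comp (X + C 1) - p) = (derivative p).comp (X + C 1) - derivative p := by
  rw [derivative_sub, derivative_comp]
  simp

/-- Iterated: `(p.comp(X+1) − p)^{(m)} = p^{(m)}.comp(X+1) − p^{(m)}`.
[cite: Agarwal2000DifferenceEquations, Remark 1.8.1] -/
theorem iterate_derivative_comp_X_add_one_sub (p : ℝ[X]) (m : ℕ) :
    derivative^[m] (p.comp (X + C 1) - p) = (derivative^[m] p).comp (X + C 1) - derivative^[m] p := by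
  induction m with
  | zero => simp
  | succ m ih => rw [Function.iterate_succ_apply', ih, derivative_comp_X_add_one_sub, Function.iterate_succ_apply']

/-- One mean value step: `p(y+1) − p(y) = p'(ξ)` for some `ξ ∈ (y, y+1)`.
[cite: Agarwal2000DifferenceEquations, Remark 1.8.1] -/
theorem exists_fwdDiff_eval_eq_derivative_eval (p : ℝ[X]) (y : ℝ) :
    ∃ ξ : ℝ, y < ξ ∧ ξ < y + 1 ∧ fwdDiff (1 : ℝ) (fun z => p.eval z) y = (derivative p).eval ξ := by
  obtain ⟨ξ, hξ, hslope⟩ :=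
    exists_deriv_eq_slope (fun x => p.eval x) (by linarith : y < y + 1) p.continuousOn p.differentiableOn
  rw [Polynomial.deriv] at hslope
  refine ⟨ξ, hξ.1, hξ.2, ?_⟩
  rw [fwdDiff, hslope]
  simp

/-- **Iterated mean value theorem for forward differences.** For every real polynomial `p`, base point `y` and
order `m` there is `ξ ∈ [y, y+m]` with `Δ₁^m (p.eval)(y) = p^{(m)}(ξ)`.
[cite: Agarwal2000DifferenceEquations, Remark 1.8.1] -/
theorem exists_fwdDiff_iter_eval_eq_iterate_derivative_eval (m : ℕ) :
    ∀ (p : ℝ[X]) (y : ℝ), ∃ ξ : ℝ, y ≤ ξ ∧ ξ ≤ y + m ∧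
      (fwdDiff (1 : ℝ))^[m] (fun z => p.eval z) y = (derivative^[m] p).eval ξ := by
  induction m with
  | zero => intro p y; exact ⟨y, le_rfl, by simp, by simp⟩
  | succ m ih =>
    intro p y
    -- `Δ^{m+1} (p.eval) = Δ^m (Δ (p.eval)) = Δ^m ((p.comp(X+1) − p).eval)`
    have hshift : fwdDiff (1 : ℝ) (fun z => p.eval z) = fun z => (p.comp (X + C 1) - p).eval z := by
      funext z; rw [eval_comp_X_add_one_sub]
    rw [Function.iterate_succ_apply, hshift]
    obtain ⟨ξ₁, h1, h2, hξ₁⟩ := ih (p.comp (X + C 1) - p) y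
    rw [hξ₁, iterate_derivative_comp_X_add_one_sub]
    -- `(q.comp(X+1) − q)(ξ₁) = q(ξ₁+1) − q(ξ₁) = q'(ξ)`, `q = p^{(m)}`
    obtain ⟨ξ, h3, h4, hξ⟩ := exists_fwdDiff_eval_eq_derivative_eval (derivative^[m] p) ξ₁
    refine ⟨ξ, by linarith, by push_cast; linarith, ?_⟩
    rw [eval_comp_X_add_one_sub, hξ, ← Function.iterate_succ_apply' derivative m p]

/-! ### §2 The logarithmic-derivative bound for a product of linear factors -/

/-- Leibniz for one linear factor: `((X − a)·q)^{(m)} = (X − a)·q^{(m)} + m·q^{(m−1)}`.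
[cite: Agarwal2000DifferenceEquations, Remark 1.8.1] -/
theorem iterate_derivative_X_sub_C_mul (a : ℝ) (q : ℝ[X]) (m : ℕ) :
    derivative^[m] ((X - C a) * q) = (X - C a) * derivative^[m] q + m • derivative^[m - 1] q := by
  rw [sub_mul, iterate_derivative_sub, mul_comm X q, iterate_derivative_mul_X, iterate_derivative_C_mul]
  ring

/-- `b^m + m·b^{m−1} ≤ (b+1)^m` for `b ≥ 0`, `m ≥ 1` (two terms of the binomial expansion).
[cite: Feller1968, Ch. II §12] -/
theorem pow_add_mul_pow_le_succ_pow {b : ℝ} (hb : 0 ≤ b) :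
    ∀ m : ℕ, 1 ≤ m → b ^ m + m * b ^ (m - 1) ≤ (b + 1) ^ m
  | 0, h => absurd h (by norm_num)
  | 1, _ => by norm_num
  | (m + 2), _ => by
    have ih := pow_add_mul_pow_le_succ_pow hb (m + 1) (by omega)
    rw [show m + 1 - 1 = m by omega] at ih
    rw [show m + 2 - 1 = m + 1 by omega, pow_succ (b + 1) (m + 1)]
    have hbm : 0 ≤ b ^ m := pow_nonneg hb m
    have h1 : (b ^ (m + 1) + (m + 1 : ℕ) * b ^ m) * (b + 1) ≤ (b + 1) ^ (m + 1) * (b + 1) :=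
      mul_le_mul_of_nonneg_right ih (by linarith)
    have h2 : b ^ (m + 2) + ((m + 2 : ℕ) : ℝ) * b ^ (m + 1) ≤ (b ^ (m + 1) + (m + 1 : ℕ) * b ^ m) * (b + 1) := by
      have e : (b ^ (m + 1) + ((m + 1 : ℕ) : ℝ) * b ^ m) * (b + 1) =
          b ^ (m + 2) + ((m + 2 : ℕ) : ℝ) * b ^ (m + 1) + ((m + 1 : ℕ) : ℝ) * b ^ m := by
        push_cast; ring
      rw [e]
      have : 0 ≤ ((m + 1 : ℕ) : ℝ) * b ^ m := by positivity
      linarith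
    exact h2.trans h1

/-- **The logarithmic-derivative bound.** For `P = Π_{i<b}(X − r_i)` and a point `ξ` with `|ξ − r_i| ≥ R > 0` for
all `i < b`: `|P^{(m)}(ξ)| ≤ (b/R)^m·|P(ξ)|` for every `m`. [cite: Agarwal2000DifferenceEquations, Remark 1.8.1] -/
theorem abs_iterate_derivative_eval_prod_le (r : ℕ → ℝ) {R : ℝ} (hR : 0 < R) (ξ : ℝ) :
    ∀ b : ℕ, (∀ i, i < b → R ≤ |ξ - r i|) → ∀ m : ℕ,
      |(derivative^[m] (∏ i ∈ range b, (X - C (r i)))).eval ξ| ≤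
        ((b : ℝ) / R) ^ m * |(∏ i ∈ range b, (X - C (r i))).eval ξ| := by
  intro b
  induction b with
  | zero =>
    intro _ m
    rcases m with _ | m
    · simp
    · simp [iterate_derivative_one]
  | succ b ih =>
    intro hfar m
    have hfar' : ∀ i, i < b → R ≤ |ξ - r i| := fun i hi => hfar i (by omega)
    have hb' := ih hfar'
    have hRb : R ≤ |ξ - r b| := hfar b (by omega)
    rw [prod_range_succ, mul_comm]
    rcases m with _ | m
    · simp
    rw [iterate_derivative_X_sub_C_mul, show m + 1 - 1 = m by omega, eval_add, eval_mul, eval_smul,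
      eval_sub, eval_X, eval_C, nsmul_eq_mul]
    have hP0 : 0 ≤ |(∏ i ∈ range b, (X - C (r i))).eval ξ| := abs_nonneg _
    obtain ⟨Q, hQ⟩ : ∃ e : ℝ, e = |(∏ i ∈ range b, (X - C (r i))).eval ξ| := ⟨_, rfl⟩
    rw [← hQ] at hb' hP0
    have h1 := hb' (m + 1)
    have h2 := hb' m
    have hbR : 0 ≤ (b : ℝ) / R := div_nonneg (Nat.cast_nonneg _) hR.le
    -- `|(ξ − a) q^{(m+1)}(ξ) + (m+1) q^{(m)}(ξ)| ≤ |ξ−a| (b/R)^{m+1} Q + (m+1)(b/R)^m Q`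
    calc |(ξ - r b) * (derivative^[m + 1] (∏ i ∈ range b, (X - C (r i)))).eval ξ +
            ((m + 1 : ℕ) : ℝ) * (derivative^[m] (∏ i ∈ range b, (X - C (r i)))).eval ξ|
        ≤ |ξ - r b| * (((b : ℝ) / R) ^ (m + 1) * Q) + ((m + 1 : ℕ) : ℝ) * (((b : ℝ) / R) ^ m * Q) := by
          refine (abs_add_le _ _).trans (add_le_add ?_ ?_)
          · rw [abs_mul]; exact mul_le_mul_of_nonneg_left h1 (abs_nonneg _)
          · rw [abs_mul, Nat.abs_cast]; exact mul_le_mul_of_nonneg_left h2 (Nat.cast_nonneg _)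
      _ ≤ |ξ - r b| * (((b : ℝ) / R) ^ (m + 1) * Q) +
            ((m + 1 : ℕ) : ℝ) * (((b : ℝ) / R) ^ m * Q) * (|ξ - r b| / R) := by
          have hge1 : 1 ≤ |ξ - r b| / R := by rw [le_div_iff₀ hR]; linarith
          have h0 : 0 ≤ ((m + 1 : ℕ) : ℝ) * (((b : ℝ) / R) ^ m * Q) := by positivity
          nlinarith
      _ = (((b : ℝ) / R) ^ (m + 1) + ((m + 1 : ℕ) : ℝ) * ((b : ℝ) / R) ^ m / R) * (|ξ - r b| * Q) := by ring
      _ ≤ ((((b + 1 : ℕ) : ℝ)) / R) ^ (m + 1) * (|ξ - r b| * Q) := by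
          refine mul_le_mul_of_nonneg_right ?_ (mul_nonneg (abs_nonneg _) hP0)
          have key := pow_add_mul_pow_le_succ_pow hbR (m + 1) (by omega)
          rw [show m + 1 - 1 = m by omega] at key
          have e1 : ((m + 1 : ℕ) : ℝ) * ((b : ℝ) / R) ^ m / R = (((m + 1 : ℕ) : ℝ) * ((b : ℝ) / R) ^ m) * (1 / R) := by
            ring
          have e2 : (((b + 1 : ℕ) : ℝ)) / R = (b : ℝ) / R + 1 / R := by push_cast; ring
          rw [e2]
          -- `(b/R)^{m+1} + (m+1)(b/R)^m·(1/R) ≤ (b/R + 1/R)^{m+1}`: scale `x = b/R`, `h = 1/R`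
          have hh : 0 < 1 / R := by positivity
          have := pow_add_mul_pow_le_succ_pow (b := (b : ℝ) / R / (1 / R)) (by positivity) (m + 1) (by omega)
          rw [show m + 1 - 1 = m by omega] at this
          have hx : (b : ℝ) / R / (1 / R) = b := by field_simp
          rw [hx] at this
          -- `b^{m+1} + (m+1) b^m ≤ (b+1)^{m+1}`; multiply by `(1/R)^{m+1}`
          have hmul := mul_le_mul_of_nonneg_right this (pow_nonneg hh.le (m + 1))
          have e3 : ((b : ℝ) ^ (m + 1) + ((m + 1 : ℕ) : ℝ) * (b : ℝ) ^ m) * (1 / R) ^ (m + 1) =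
              ((b : ℝ) / R) ^ (m + 1) + ((m + 1 : ℕ) : ℝ) * ((b : ℝ) / R) ^ m / R := by
            rw [one_div_pow, div_pow, div_pow, pow_succ R m]
            field_simp
          have e4 : ((b : ℝ) + 1) ^ (m + 1) * (1 / R) ^ (m + 1) = ((b : ℝ) / R + 1 / R) ^ (m + 1) := by
            rw [← mul_pow]; congr 1; field_simp
          rw [e3, e4] at hmul
          exact hmul
      _ = ((((b + 1 : ℕ) : ℝ)) / R) ^ (m + 1) * |((X - C (r b)) * ∏ i ∈ range b, (X - C (r i))).eval ξ| := by
          rw [eval_mul, abs_mul, eval_sub, eval_X, eval_C, hQ]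
    exact le_rfl

/-! ### §3 Moving the evaluation point -/

/-- **Comparison of values at nearby points.** If `|ξ − y| ≤ m` and `|y − r_i| ≥ R + m` (`R > 0`) for all `i < b`,
then `|P(ξ)| ≤ e^{bm/R}·|P(y)|` for `P = Π_{i<b}(X − r_i)`. [cite: Agarwal2000DifferenceEquations, Remark 1.8.1] -/
theorem abs_eval_prod_le_exp_mul (r : ℕ → ℝ) {R m : ℝ} (hR : 0 < R) (hm : 0 ≤ m) {y ξ : ℝ} (hξ : |ξ - y| ≤ m) :
    ∀ b : ℕ, (∀ i, i < b → R + m ≤ |y - r i|) →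
      |(∏ i ∈ range b, (X - C (r i))).eval ξ| ≤ Real.exp (b * m / R) * |(∏ i ∈ range b, (X - C (r i))).eval y| := by
  intro b
  induction b with
  | zero => intro _; simp
  | succ b ih =>
    intro hfar
    have hb := ih fun i hi => hfar i (by omega)
    have hyb : R + m ≤ |y - r b| := hfar b (by omega)
    rw [prod_range_succ]
    simp only [eval_mul, abs_mul, eval_sub, eval_X, eval_C]
    -- `|ξ − r_b| ≤ |y − r_b| + m ≤ |y − r_b|·(1 + m/R) ≤ |y − r_b|·e^{m/R}`
    have h1 : |ξ - r b| ≤ |y - r b| + m := by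
      have := abs_sub_le ξ y (r b); linarith
    have hy0 : 0 < |y - r b| := by linarith
    have h2 : |y - r b| + m ≤ |y - r b| * Real.exp (m / R) := by
      have hexp : 1 + m / R ≤ Real.exp (m / R) := by linarith [Real.add_one_le_exp (m / R)]
      have h3 : |y - r b| * (1 + m / R) ≤ |y - r b| * Real.exp (m / R) := mul_le_mul_of_nonneg_left hexp hy0.le
      have h4 : m ≤ |y - r b| * (m / R) := by
        rw [mul_div_assoc', le_div_iff₀ hR]; nlinarith
      nlinarith
    have hP0 : 0 ≤ |(∏ i ∈ range b, (X - C (r i))).eval ξ| := abs_nonneg _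
    calc |(∏ i ∈ range b, (X - C (r i))).eval ξ| * |ξ - r b|
        ≤ (Real.exp (b * m / R) * |(∏ i ∈ range b, (X - C (r i))).eval y|) * (|y - r b| * Real.exp (m / R)) :=
          mul_le_mul hb (h1.trans h2) (abs_nonneg _) (by positivity)
      _ = Real.exp (((b + 1 : ℕ) : ℝ) * m / R) * (|(∏ i ∈ range b, (X - C (r i))).eval y| * |y - r b|) := by
          rw [show ((b + 1 : ℕ) : ℝ) * m / R = b * m / R + m / R by push_cast; ring, Real.exp_add]; ring

/-! ### §4 The far-roots difference bound -/

/-- **THE FAR-ROOTS DIFFERENCE BOUND.** Let `P = Π_{i<b}(X − r_i)` with real roots `r_i`, `y ∈ ℝ`, `m ∈ ℕ` and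
`R > 0` with `|y − r_i| ≥ R + m` for all `i < b`. Then `|Δ₁^m (P.eval)(y)| ≤ (b/R)^m·e^{bm/R}·|P(y)|`.
(§1: `Δ^m P(y) = P^{(m)}(ξ)`, `ξ ∈ [y, y+m]`; §2 at `ξ` with `dist(ξ, roots) ≥ R`; §3.)
[cite: Agarwal2000DifferenceEquations, Remark 1.8.1] -/
theorem abs_fwdDiff_iter_eval_prod_le (r : ℕ → ℝ) (b m : ℕ) {R : ℝ} (hR : 0 < R) (y : ℝ)
    (hfar : ∀ i, i < b → R + m ≤ |y - r i|) :
    |(fwdDiff (1 : ℝ))^[m] (fun z => (∏ i ∈ range b, (X - C (r i))).eval z) y| ≤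
      ((b : ℝ) / R) ^ m * Real.exp (b * m / R) * |(∏ i ∈ range b, (X - C (r i))).eval y| := by
  obtain ⟨ξ, h1, h2, hξ⟩ := exists_fwdDiff_iter_eval_eq_iterate_derivative_eval m (∏ i ∈ range b, (X - C (r i))) y
  rw [hξ]
  have hξy : |ξ - y| ≤ m := by rw [abs_le]; constructor <;> linarith
  have hfarξ : ∀ i, i < b → R ≤ |ξ - r i| := by
    intro i hi
    have := hfar i hi
    have := abs_sub_le y ξ (r i)  -- |y - r i| ≤ |y - ξ| + |ξ - r i|
    rw [abs_sub_comm y ξ] at this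
    linarith
  have hA := abs_iterate_derivative_eval_prod_le r hR ξ b hfarξ m
  have hB := abs_eval_prod_le_exp_mul r hR (Nat.cast_nonneg m) hξy b hfar
  calc _ ≤ ((b : ℝ) / R) ^ m * |(∏ i ∈ range b, (X - C (r i))).eval ξ| := hA
    _ ≤ ((b : ℝ) / R) ^ m * (Real.exp (b * m / R) * |(∏ i ∈ range b, (X - C (r i))).eval y|) :=
        mul_le_mul_of_nonneg_left hB (by positivity)
    _ = _ := by ring

/-- The same for a constant multiple `c·Π(X − r_i)` (differences are linear).
[cite: Agarwal2000DifferenceEquations, Remark 1.8.1] -/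
theorem abs_fwdDiff_iter_eval_const_mul_prod_le (r : ℕ → ℝ) (b m : ℕ) {R : ℝ} (hR : 0 < R) (y c : ℝ)
    (hfar : ∀ i, i < b → R + m ≤ |y - r i|) :
    |(fwdDiff (1 : ℝ))^[m] (fun z => c * (∏ i ∈ range b, (X - C (r i))).eval z) y| ≤
      ((b : ℝ) / R) ^ m * Real.exp (b * m / R) * |c * (∏ i ∈ range b, (X - C (r i))).eval y| := by
  have hlin : (fwdDiff (1 : ℝ))^[m] (fun z => c * (∏ i ∈ range b, (X - C (r i))).eval z) y =
      c * (fwdDiff (1 : ℝ))^[m] (fun z => (∏ i ∈ range b, (X - C (r i))).eval z) y := by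
    rw [fwdDiff_iter_eq_sum_shift, fwdDiff_iter_eq_sum_shift, mul_sum]
    refine sum_congr rfl fun k _ => ?_
    rw [zsmul_eq_mul, zsmul_eq_mul]; ring
  rw [hlin, abs_mul, abs_mul]
  calc |c| * |(fwdDiff (1 : ℝ))^[m] (fun z => (∏ i ∈ range b, (X - C (r i))).eval z) y|
      ≤ |c| * (((b : ℝ) / R) ^ m * Real.exp (b * m / R) * |(∏ i ∈ range b, (X - C (r i))).eval y|) :=
        mul_le_mul_of_nonneg_left (abs_fwdDiff_iter_eval_prod_le r b m hR y hfar) (abs_nonneg c)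
    _ = _ := by ring

end RealRootedFarDifferences

end Literature.Algebra.Polynomial

end
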